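import Mathlib
import HarnessLib
import Summits.NavierStokesRegularity.NavierStokesRegularity.Theses.LoopPeriodRatchet
import Summits.NavierStokesRegularity.NavierStokesRegularity.Theorems.LoopPeriodRatchetNoLoopsOfGrowth
import Summits.NavierStokesRegularity.NavierStokesRegularity.Theorems.LoopPeriodRatchetPeriodScalingBound

/-!
# Route `LoopPeriodRatchet`, item `FrequencyGrowthExponent` (⟨stmt-NavierStokesRegularity-27893⟩, the shared wall S6G of the THICK column of crux
# `PoloidalWindowRigidity` 19708 / item 20428) — THE WALL TYPED EXACTLY: `FrequencyGrowthExponent ↔ NoLoops`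

Cell ns-regularity-ideate, seat ns-poloidal-K2-p2 g13 (K2 hand).  Port to Theorems level of the sorry-free kernel memo `Cruxes/PoloidalWindowRigidity/Lines/noloops_wall.lean`
(ns-idea-8 g6, 2026-08-28; «registration-ready, files only»), statements and proofs VERBATIM: the backward period-growth exponent statement 27893
`LoopPeriodRatchet.FrequencyGrowthExponent` is EQUIVALENT — given the tree's PROVED `periodScalingBound_proof` and `noLoopsOfGrowth_proof` — to the bare
statement «NoLoops» (VERBATIM the conclusion of `LoopPeriodRatchet.NoLoopsOfGrowth`: an e₃-poloidal class Type-I ancient mild profile carries no closed vortex line with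
vorticity at any time).  `NoLoops ⇒ 27893` is vacuous (`A := 1`, `κ := 0`); `27893 ⇒ NoLoops` is the tree's engine.  Companion of the finer kernel theorem
`…LoopIslandReduction.frequencyGrowthExponent_iff_noIslands` (p676353): 27893 ⟺ NoIslands ⟹ NoLoops.

HONEST LABEL: a typing/equivalence theorem on hypothetical profiles; the growth-exponent packaging of 27893 carries no slack; 27893 / 19708 / 20428 / 22881 OPEN;
no claim about Navier–Stokes regularity.  Known sub-stratum of NoLoops: axisymmetric no-swirl (KNSS 2009 Thm 5.2).
-/

-- the summit and its single sub-problem share the name (CONVENTIONS §1), as in every Theorems file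
set_option linter.dupNamespace false

open scoped InnerProductSpace RealInnerProductSpace

namespace Summit.NavierStokesRegularity.NavierStokesRegularity.Theorems.LoopPeriodRatchetNoLoopsWall

open Summit.NavierStokesRegularity.NavierStokesRegularity.Theses.LoopPeriodRatchet
open Summit.NavierStokesRegularity.NavierStokesRegularity.Theorems

/-- NoLoops ⇒ 27893 (vacuously: `A := 1`, `κ := 0`; a non-stationary periodic vortex line contradicts NoLoops applied to the
re-parametrised orbit `θ ↦ c (θ + s₀)`). The hypothesis is VERBATIM the conclusion of `LoopPeriodRatchet.NoLoopsOfGrowth`. -/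
theorem frequencyGrowthExponent_of_noLoops
    (h : (∀ (C : ℝ) (v : ℝ → EuclideanSpace ℝ (Fin 3) → EuclideanSpace ℝ (Fin 3)), Literature.Analysis.FluidPDE.HasTypeITimeDecay C v → ContinuousOn (Function.uncurry v) (Set.Iio (0 : ℝ) ×ˢ Set.univ) → (∀ s t : ℝ, s < t → t < 0 → ∀ x, v t x = Literature.Analysis.UnboundedOperators.heatExtension (v s) (t - s) x - Literature.Analysis.FluidPDE.oseenDuhamel 1 s v v t x) → (∀ t < 0, Literature.Analysis.FluidPDE.VectorCalculus.IsDivFree (v t)) → (∀ s < 0, ∀ y, ⟪Literature.Analysis.FluidPDE.curl (v s) y, EuclideanSpace.single 2 1⟫_ℝ = 0) → ∀ s : ℝ, s < 0 → ∀ (γ : ℝ → EuclideanSpace ℝ (Fin 3)) (ℓ : ℝ), 0 < ℓ → (∀ θ, HasDerivAt γ (Literature.Analysis.FluidPDE.curl (v s) (γ θ)) θ) → (∀ θ, γ (θ + ℓ) = γ θ) → Literature.Analysis.FluidPDE.curl (v s) (γ 0) = 0)) :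
    FrequencyGrowthExponent := by
  intro C v hd hc hm hdf hpol
  refine ⟨1, 0, one_pos, by norm_num, ?_⟩
  intro t₀ t _ht₀ ht c T hT hper hder hne
  obtain ⟨s₀, hs₀⟩ := hne
  exfalso
  apply hs₀
  have key := h C v hd hc hm hdf hpol t ht (fun θ => c (θ + s₀)) T hT
    (fun θ => (hder (θ + s₀)).comp_add_const θ s₀)
    (fun θ => by
      show c (θ + T + s₀) = c (θ + s₀)
      rw [add_right_comm]
      exact hper (θ + s₀))
  simpa using key

/-- 27893 ⇒ NoLoops: the tree's engine `noLoopsOfGrowth_proof` fed with the PROVED `periodScalingBound_proof`. -/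
theorem noLoops_of_frequencyGrowthExponent (hG : FrequencyGrowthExponent) :
    (∀ (C : ℝ) (v : ℝ → EuclideanSpace ℝ (Fin 3) → EuclideanSpace ℝ (Fin 3)), Literature.Analysis.FluidPDE.HasTypeITimeDecay C v → ContinuousOn (Function.uncurry v) (Set.Iio (0 : ℝ) ×ˢ Set.univ) → (∀ s t : ℝ, s < t → t < 0 → ∀ x, v t x = Literature.Analysis.UnboundedOperators.heatExtension (v s) (t - s) x - Literature.Analysis.FluidPDE.oseenDuhamel 1 s v v t x) → (∀ t < 0, Literature.Analysis.FluidPDE.VectorCalculus.IsDivFree (v t)) → (∀ s < 0, ∀ y, ⟪Literature.Analysis.FluidPDE.curl (v s) y, EuclideanSpace.single 2 1⟫_ℝ = 0) → ∀ s : ℝ, s < 0 → ∀ (γ : ℝ → EuclideanSpace ℝ (Fin 3)) (ℓ : ℝ), 0 < ℓ → (∀ θ, HasDerivAt γ (Literature.Analysis.FluidPDE.curl (v s) (γ θ)) θ) → (∀ θ, γ (θ + ℓ) = γ θ) → Literature.Analysis.FluidPDE.curl (v s) (γ 0) = 0) :=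
  LoopPeriodRatchetNoLoopsOfGrowth.noLoopsOfGrowth_proof hG LoopPeriodRatchetPeriodScalingBound.periodScalingBound_proof

/-- THE WALL, typed exactly: item 27893 `FrequencyGrowthExponent` ⟺ NoLoops (kernel-checked, no sorry). -/
theorem frequencyGrowthExponent_iff_noLoops :
    FrequencyGrowthExponent ↔ (∀ (C : ℝ) (v : ℝ → EuclideanSpace ℝ (Fin 3) → EuclideanSpace ℝ (Fin 3)), Literature.Analysis.FluidPDE.HasTypeITimeDecay C v → ContinuousOn (Function.uncurry v) (Set.Iio (0 : ℝ) ×ˢ Set.univ) → (∀ s t : ℝ, s < t → t < 0 → ∀ x, v t x = Literature.Analysis.UnboundedOperators.heatExtension (v s) (t - s) x - Literature.Analysis.FluidPDE.oseenDuhamel 1 s v v t x) → (∀ t < 0, Literature.Analysis.FluidPDE.VectorCalculus.IsDivFree (v t)) → (∀ s < 0, ∀ y, ⟪Literature.Analysis.FluidPDE.curl (v s) y, EuclideanSpace.single 2 1⟫_ℝ = 0) → ∀ s : ℝ, s < 0 → ∀ (γ : ℝ → EuclideanSpace ℝ (Fin 3)) (ℓ : ℝ), 0 < ℓ → (∀ θ,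 HasDerivAt γ (Literature.Analysis.FluidPDE.curl (v s) (γ θ)) θ) → (∀ θ, γ (θ + ℓ) = γ θ) → Literature.Analysis.FluidPDE.curl (v s) (γ 0) = 0) :=
  ⟨noLoops_of_frequencyGrowthExponent, frequencyGrowthExponent_of_noLoops⟩

end Summit.NavierStokesRegularity.NavierStokesRegularity.Theorems.LoopPeriodRatchetNoLoopsWall
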